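import Summits.BirchSwinnertonDyer.BirchSwinnertonDyer.Theorems.PrintCf2SplitBadTwoCMShaConjugationSwap
import HarnessLib

/-!
# Crux `PrintCf2.SplitBadTwoRankOneOfFacts` (item stmt-BirchSwinnertonDyer-20368), road α over the CM field:
# the INVARIANTS of complex conjugation on `Ш(E_K/K)[2^∞]` are ONE CM-primary part, exactly —
# `#Ш(E_K/K)[2^∞]^{+} = #Ш(E_K/K)[2^∞]^{−} = #Ш[𝔭^∞]` and `#Ш(E_K/K)[2^∞] = (#Ш(E_K/K)[2^∞]^{+})²`, with no `2`-invertibility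

Cell `bsd-print-cf2`, width seat `bsd-line-cf2-p1-w8` g0 (brick **B6b**, sequel of B4 p648048 / B6 p649957 + p650651);
`--supports stmt-BirchSwinnertonDyer-20368` (helper). HONEST FRAMING: nothing here closes a crux or a stub; BSD is not proved by any
of this; no summit statement is proved by this seat. No definition is introduced. beyond-print theorem: no (bookkeeping).

WHY. At an ODD prime `p` a `Gal(K/ℚ) = ⟨c⟩`-module splits as `M = M⁺ ⊕ M⁻` by the idempotents `(1 ± c)/2` (Gross 1991, (5.1));
at `p = 2 = [K₀:ℚ]` this fails in general and the `±` bookkeeping of a `C₂`-descent loses `2`-torsion. For the CM class of the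
crux there is no loss: `Ш(E_K/K)[2^∞] = Ш[𝔭^∞] ⊕ Ш[𝔭̄^∞]` (-w2 g7's eigen-decomposition of `Ш(π)`, this seat's B6) and complex
conjugation SWAPS the two summands (B6 `exists_conjugating_lift`), so its fixed subgroup is the GRAPH `{x + c x : x ∈ Ш[𝔭^∞]}`
— isomorphic to `Ш[𝔭^∞]` on the nose.

* §1 (generic, any abelian group): complementary subgroups `C₁ ⊓ C₂ = ⊥`, `C₁ ⊔ C₂ = ⊤` and an additive involution `g`
  swapping them ⟹ `x ↦ x + g x` is a bijection `C₁ → ker(g − id)` and `x ↦ x − g x` a bijection `C₁ → ker(g + id)`: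
  `natCard_ker_sub_id_eq_of_swap`, `natCard_ker_add_id_eq_of_swap` (`#M^{g} = #M^{−g} = #C₁`), `natCard_eq_of_swap` (`#C₁ = #C₂`),
  `natCard_eq_sq_natCard_ker_sub_id_of_swap` (`#M = (#M^{g})²`).
* §2 (the tree's `Ш`): `E = W/ℚ` elliptic, `K/ℚ` Galois totally complex, `σ ∈ Aut(K/ℚ)` an INVOLUTION with a lift `τ` conjugating
  an endo-isogeny `φ` of `E_K` with `φ(φP) = φP − 2P` (`φ(τQ) = τQ − τ(φQ)`): `τ_*` restricts to an involution `s` of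
  `M = Ш(E_K/K)[2^∞]` with **`#ker(s − id) = #Ш[𝔭^∞] = #Ш[𝔭̄^∞]`** and **`#M = (#ker(s − id))²`** (`exists_conj_involution_card_sha`).
* §3 (`K` imaginary quadratic ∋ √−7, `j = −3375`): the conjugating `σ'` of B6 is `≠ 1` (a lift of `1` lies in `Γ_K` and COMMUTES with
  `φ`; on `0 ≠ Q ∈ ker φ` this contradicts the anti-commutation), hence equals THE non-trivial automorphism (`#Aut(K/ℚ) = 2`,
  `IsGalois.card_aut_eq_finrank`): **for `σ ≠ 1` and ANY lift `τ`, `τ_*|_{Ш[2^∞]}` is an involution whose fixed subgroup has the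
  cardinality of `Ш[𝔭^∞]`, and `#Ш(W_K/K)[2^∞]` is its square** (`exists_cm_involution_card_sha_of_isImaginaryQuadratic`). The tree's
  `conjH1Points_shaRestriction` places `res Ш(W/ℚ)` inside that fixed subgroup; the kernel/cokernel of `res` (the `H^•(C₂, W(K))`
  bookkeeping of S3c's `C₂`-descent) is NOT treated here.

References: B. H. Gross, LMS LNS 153 (1991) §5 (5.1); K. Rubin, LNM 1716 (1999) §2; J.-P. Serre, *Galois Cohomology*, I.§2.4.
-/

noncomputable section

open scoped Classical

set_option linter.dupNamespace false
set_option autoImplicit false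

namespace Summit.BirchSwinnertonDyer.BirchSwinnertonDyer.Theorems.PrintCf2.CMPrimes

open WeierstrassCurve Literature.NumberTheory.EllipticCurves Field NumberField
open Summit.BirchSwinnertonDyer.BirchSwinnertonDyer.Theorems

/-! ## §1 Generic: the fixed subgroup of an involution swapping two complementary subgroups -/

section Swap

variable {M : Type*} [AddCommGroup M] {C₁ C₂ : AddSubgroup M}

/-- **`#C₁ = #C₂` under a swapping involution** (no eigen-structure needed): `g` restricts to a bijection `C₁ → C₂` with inverse
`g|_{C₂}`. [folklore] -/
theorem natCard_eq_of_swap (g : M →+ M) (hgg : ∀ x, g (g x) = x) (h12 : ∀ x ∈ C₁, g x ∈ C₂) (h21 : ∀ x ∈ C₂, g x ∈ C₁) :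
    Nat.card C₁ = Nat.card C₂ :=
  Nat.card_congr
    { toFun := fun x ↦ ⟨g x, h12 x x.2⟩
      invFun := fun y ↦ ⟨g y, h21 y y.2⟩
      left_inv := fun x ↦ Subtype.ext (hgg x)
      right_inv := fun y ↦ Subtype.ext (hgg y) }

/-- **The fixed subgroup of a swapping involution is the graph of `g|_{C₁}`**: for complementary `C₁`, `C₂` (`C₁ ⊓ C₂ = ⊥`,
`C₁ ⊔ C₂ = ⊤`) and an additive involution `g` with `g(C₁) ⊆ C₂`, `g(C₂) ⊆ C₁`, the map `x ↦ x + g x` is a bijection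
`C₁ → ker(g − id)`; hence `#ker(g − id) = #C₁`. (At `p = 2` this replaces the idempotent `(1 + g)/2`.) [folklore] -/
theorem natCard_ker_sub_id_eq_of_swap (hinf : C₁ ⊓ C₂ = ⊥) (hsup : C₁ ⊔ C₂ = ⊤) (g : M →+ M) (hgg : ∀ x, g (g x) = x)
    (h12 : ∀ x ∈ C₁, g x ∈ C₂) (h21 : ∀ x ∈ C₂, g x ∈ C₁) :
    Nat.card (g - AddMonoidHom.id M).ker = Nat.card C₁ := by
  refine (Nat.card_eq_of_bijective (fun x : C₁ ↦ (⟨(x : M) + g x, ?_⟩ : (g - AddMonoidHom.id M).ker)) ⟨?_, ?_⟩).symm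
  · rw [AddMonoidHom.mem_ker, AddMonoidHom.sub_apply, AddMonoidHom.id_apply, map_add, hgg]
    abel
  · rintro ⟨x, hx⟩ ⟨y, hy⟩ h
    have h' : x + g x = y + g y := congrArg Subtype.val h
    exact Subtype.ext (eq_of_add_eq_add_of_inf_eq_bot hinf hx (h12 x hx) hy (h12 y hy) h').1
  · rintro ⟨z, hz⟩
    rw [AddMonoidHom.mem_ker, AddMonoidHom.sub_apply, AddMonoidHom.id_apply, sub_eq_zero] at hz
    have hz' : z ∈ C₁ ⊔ C₂ := hsup ▸ AddSubgroup.mem_top z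
    obtain ⟨x, hx, y, hy, rfl⟩ := AddSubgroup.mem_sup.mp hz'
    -- `g x + g y = x + y` with `g y ∈ C₁`, `g x ∈ C₂` ⇒ `g x = y`
    rw [map_add, add_comm (g x)] at hz
    have hgx : g x = y := (eq_of_add_eq_add_of_inf_eq_bot hinf (h21 y hy) (h12 x hx) hx hy hz).2
    exact ⟨⟨x, hx⟩, Subtype.ext (by simp [hgx])⟩

/-- **The anti-fixed subgroup likewise**: `x ↦ x − g x` is a bijection `C₁ → ker(g + id)`, so `#ker(g + id) = #C₁`. [folklore] -/
theorem natCard_ker_add_id_eq_of_swap (hinf : C₁ ⊓ C₂ = ⊥) (hsup : C₁ ⊔ C₂ = ⊤) (g : M →+ M) (hgg : ∀ x, g (g x) = x)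
    (h12 : ∀ x ∈ C₁, g x ∈ C₂) (h21 : ∀ x ∈ C₂, g x ∈ C₁) :
    Nat.card (g + AddMonoidHom.id M).ker = Nat.card C₁ := by
  refine (Nat.card_eq_of_bijective (fun x : C₁ ↦ (⟨(x : M) - g x, ?_⟩ : (g + AddMonoidHom.id M).ker)) ⟨?_, ?_⟩).symm
  · rw [AddMonoidHom.mem_ker, AddMonoidHom.add_apply, AddMonoidHom.id_apply, map_sub, hgg]
    abel
  · rintro ⟨x, hx⟩ ⟨y, hy⟩ h
    have h' : x + g (-x) = y + g (-y) := by
      have := congrArg Subtype.val h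
      simpa [sub_eq_add_neg, map_neg] using this
    exact Subtype.ext (eq_of_add_eq_add_of_inf_eq_bot hinf hx (h12 _ (C₁.neg_mem hx)) hy (h12 _ (C₁.neg_mem hy)) h').1
  · rintro ⟨z, hz⟩
    rw [AddMonoidHom.mem_ker, AddMonoidHom.add_apply, AddMonoidHom.id_apply, add_eq_zero_iff_eq_neg] at hz
    have hz' : z ∈ C₁ ⊔ C₂ := hsup ▸ AddSubgroup.mem_top z
    obtain ⟨x, hx, y, hy, rfl⟩ := AddSubgroup.mem_sup.mp hz'
    -- `g x + g y = -x + -y` with `g y ∈ C₁`, `g x ∈ C₂` ⇒ `g x = -y`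
    rw [map_add, neg_add, add_comm (g x)] at hz
    have hgx : g x = -y :=
      (eq_of_add_eq_add_of_inf_eq_bot hinf (h21 y hy) (h12 x hx) (C₁.neg_mem hx) (C₂.neg_mem hy) hz).2
    exact ⟨⟨x, hx⟩, Subtype.ext (by simp [hgx])⟩

/-- **`#M = (#M^{g})²`** for complementary subgroups swapped by an involution `g` (`M^{g} = ker(g − id)`): `#M = #C₁·#C₂`
(B4 `natCard_eq_mul_of_inf_eq_bot_of_sup_eq_top`), `#C₁ = #C₂ = #ker(g − id)`. `Nat.card`; no finiteness. [folklore] -/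
theorem natCard_eq_sq_natCard_ker_sub_id_of_swap (hinf : C₁ ⊓ C₂ = ⊥) (hsup : C₁ ⊔ C₂ = ⊤) (g : M →+ M)
    (hgg : ∀ x, g (g x) = x) (h12 : ∀ x ∈ C₁, g x ∈ C₂) (h21 : ∀ x ∈ C₂, g x ∈ C₁) :
    Nat.card M = Nat.card (g - AddMonoidHom.id M).ker ^ 2 := by
  rw [natCard_eq_mul_of_inf_eq_bot_of_sup_eq_top hinf hsup, ← natCard_eq_of_swap g hgg h12 h21,
    ← natCard_ker_sub_id_eq_of_swap hinf hsup g hgg h12 h21, sq]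

end Swap

/-! ## §2 On `Ш(E_K/K)[2^∞]`: the fixed subgroup of `τ_*` for an involution `σ` with a conjugating lift -/

section Sha

variable (W : WeierstrassCurve ℚ) [W.IsElliptic] {K : Type} [Field K] [NumberField K]
variable {σ : K ≃ₐ[ℚ] K} {τ : AlgebraicClosure K ≃+* AlgebraicClosure K}

omit [W.IsElliptic] in
/-- **`#Ш(E_K/K)[2^∞]^{τ} = #Ш[𝔭^∞] = #Ш[𝔭̄^∞]` and `#Ш(E_K/K)[2^∞] = (#Ш(E_K/K)[2^∞]^{τ})²`.** `E = W/ℚ` elliptic; `K` a number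
field with all infinite places complex; `σ ∈ Aut(K/ℚ)` with `σ² = 1` and a lift `τ`; `φ` an endo-isogeny of `E_K` over `K` with
`φ(φP) = φP − 2P` and `φ(τQ) = τQ − τ(φQ)` on `E(K̄)`; `r ∈ ℤ₂` any root of `X² − X + 2`; `C = Ш[𝔭^∞]` ≤ `M = Ш(E_K/K)[2^∞]` the
subgroup where `Ш(φ)` acts as `r` (read on `H¹(K, E)`). Then `τ_*` restricts to an additive involution `s` of `M` over
`IsLiftOfAut.conjH1Points`, and `#ker(s − id) = #ker(s + id) = #C`, `#M = (#ker(s − id))²` (`Nat.card`; no finiteness of `Ш`).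
[cite: GrossLMS1991, §5 (5.1)] [cite: SilvermanATAEC1994, II §2 Thm. 2.2(b) and App. A §3 (row D = -7)] -/
theorem exists_conj_involution_card_sha (hK : ∀ w : InfinitePlace K, w.IsComplex) (hσ : σ * σ = 1) (hτ : IsLiftOfAut σ τ)
    (φ : Isogeny (W.baseChange K) (W.baseChange K)) (hrel : ∀ P, φ (φ P) = φ P - 2 • P)
    (hanti : ∀ Q, φ (hτ.pointsMap W Q) = hτ.pointsMap W Q - hτ.pointsMap W (φ Q))
    {r : ℤ_[2]} (hr : r * r = r - 2)
    {C : AddSubgroup (AddCommGroup.primaryComponent (W.baseChange K).sha 2)}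
    (hC : ∀ x, x ∈ C ↔ ∀ (k : ℕ) (N : ℤ), 2 ^ k • x = 0 →
      ((N : ℤ_[2]) - r) ∈ (Ideal.span {(2 : ℤ_[2]) ^ k} : Ideal ℤ_[2]) →
        galH1Map φ.toAddMonoidHom φ.equivariant
            (((x : AddCommGroup.primaryComponent (W.baseChange K).sha 2) : (W.baseChange K).sha) : (W.baseChange K).galH1) =
          N • (((x : AddCommGroup.primaryComponent (W.baseChange K).sha 2) : (W.baseChange K).sha) : (W.baseChange K).galH1)) :
    ∃ s : AddCommGroup.primaryComponent (W.baseChange K).sha 2 →+ AddCommGroup.primaryComponent (W.baseChange K).sha 2,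
      (∀ x, (((s x : AddCommGroup.primaryComponent (W.baseChange K).sha 2) : (W.baseChange K).sha) : (W.baseChange K).galH1) =
        hτ.conjH1Points W ((x : (W.baseChange K).sha) : (W.baseChange K).galH1)) ∧
      (∀ x, s (s x) = x) ∧
      Nat.card (s - AddMonoidHom.id _).ker = Nat.card C ∧
      Nat.card (s + AddMonoidHom.id _).ker = Nat.card C ∧
      Nat.card (AddCommGroup.primaryComponent (W.baseChange K).sha 2) = Nat.card (s - AddMonoidHom.id _).ker ^ 2 := by
  haveI : Fact (Nat.Prime 2) := ⟨Nat.prime_two⟩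
  set M := ↥(AddCommGroup.primaryComponent (W.baseChange K).sha 2) with hM_def
  obtain ⟨πM, hπM, hπMrel⟩ := exists_shaPi_two (W.baseChange K) φ hrel
  obtain ⟨g, hg⟩ := exists_conj_addEquiv_sha_two W hK hτ
  -- `s = g` as a homomorphism; it is an involution because `σ² = 1`
  set s : M →+ M := (g : M →+ M) with hs_def
  have hs : ∀ x, (((s x : M) : (W.baseChange K).sha) : (W.baseChange K).galH1) =
      hτ.conjH1Points W ((x : (W.baseChange K).sha) : (W.baseChange K).galH1) := fun x ↦ hg x
  have hss : ∀ x, s (s x) = x := fun x ↦ by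
    apply Subtype.ext; apply Subtype.ext
    rw [hs, hs]
    exact SylvesterTwoShaConjugation.conjH1Points_conjH1Points_of_mul_self W hσ hτ _
  -- the two eigen-subgroups of `Ш(φ)` on `M` and their complementarity
  have hsum : r + (1 - r) = ((1 : ℤ) : ℤ_[2]) := by push_cast; ring
  have hprod : r * (1 - r) = ((2 : ℤ) : ℤ_[2]) := by push_cast; linear_combination -hr
  have hunit : IsUnit (r - (1 - r)) := (two_dvd_or_two_dvd_one_sub_of_root hr).2
  have hcoe : ∀ (x : M) (N : ℤ), πM x = N • x ↔
      galH1Map φ.toAddMonoidHom φ.equivariant (((x : M) : (W.baseChange K).sha) : (W.baseChange K).galH1) =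
        N • (((x : M) : (W.baseChange K).sha) : (W.baseChange K).galH1) := fun x N ↦ by
    rw [← hπM x]
    constructor
    · intro h; rw [h, AddSubgroupClass.coe_zsmul, AddSubgroupClass.coe_zsmul]
    · intro h
      apply Subtype.ext; apply Subtype.ext
      rw [h, AddSubgroupClass.coe_zsmul, AddSubgroupClass.coe_zsmul]
  have hC₁ : ∀ x : M, x ∈ C ↔ ∀ (k : ℕ) (N : ℤ), 2 ^ k • x = 0 →
      ((N : ℤ_[2]) - r) ∈ (Ideal.span {(2 : ℤ_[2]) ^ k} : Ideal ℤ_[2]) → πM x = N • x := fun x ↦ by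
    rw [hC x]
    exact forall_congr' fun k ↦ forall_congr' fun N ↦ forall_congr' fun _ ↦ forall_congr' fun _ ↦ (hcoe x N).symm
  obtain ⟨C', hC'⟩ := exists_addSubgroup_eigen (p := 2) exists_two_pow_smul_eq_zero_primaryComponent πM (1 - r)
  obtain ⟨hinf, hsup, -⟩ := natCard_eq_natCard_eigen_mul (p := 2) exists_two_pow_smul_eq_zero_primaryComponent πM hπMrel
    hsum hprod hunit hC₁ hC'
  -- `s` anti-commutes with `Ш(φ)`, hence swaps the summands
  have hgM : ∀ x : M, πM (s x) = (1 : ℤ) • s x - s (πM x) := fun x ↦ by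
    apply Subtype.ext; apply Subtype.ext
    rw [one_smul, AddSubgroupClass.coe_sub, AddSubgroupClass.coe_sub, hπM, hs, hs, hπM]
    exact galH1Map_conjH1Points_of_anti W hτ φ.toAddMonoidHom φ.equivariant hanti _
  have hsum' : (1 - r) + r = ((1 : ℤ) : ℤ_[2]) := by push_cast; ring
  have h12 : ∀ x ∈ C, s x ∈ C' := fun x hx ↦
    (hC' _).mpr (eigen_map_of_anticommute πM s hgM hsum (exists_two_pow_smul_eq_zero_primaryComponent x) ((hC₁ x).mp hx))
  have h21 : ∀ x ∈ C', s x ∈ C := fun x hx ↦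
    (hC₁ _).mpr (eigen_map_of_anticommute πM s hgM hsum' (exists_two_pow_smul_eq_zero_primaryComponent x) ((hC' x).mp hx))
  exact ⟨s, hs, hss, natCard_ker_sub_id_eq_of_swap hinf hsup s hss h12 h21,
    natCard_ker_add_id_eq_of_swap hinf hsup s hss h12 h21, natCard_eq_sq_natCard_ker_sub_id_of_swap hinf hsup s hss h12 h21⟩

end Sha

/-! ## §3 `K` imaginary quadratic ∋ √−7, `j = −3375`: the conjugating automorphism IS complex conjugation -/

section ImaginaryQuadratic

variable (W : WeierstrassCurve ℚ) [W.IsElliptic] {K : Type} [Field K] [NumberField K]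

omit [W.IsElliptic] in
/-- **A lift of the identity commutes with every isogeny over `K`**: if `τ` lifts `1 ∈ Aut(K/ℚ)` then `τ` is a `K`-automorphism of
`K̄`, i.e. an element of `Γ_K`, and `φ (τ Q) = τ (φ Q)` for every isogeny `φ` of `E_K` defined over `K`. [folklore] -/
theorem isogeny_pointsMap_of_isLiftOfAut_one {τ : AlgebraicClosure K ≃+* AlgebraicClosure K}
    (hτ : IsLiftOfAut (1 : K ≃ₐ[ℚ] K) τ) (φ : Isogeny (W.baseChange K) (W.baseChange K))
    (Q : (W.baseChange K).geomPoints) : φ (hτ.pointsMap W Q) = hτ.pointsMap W (φ Q) := by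
  -- `τ` as an element of `Γ_K`
  let g : absoluteGaloisGroup K := (absoluteGaloisGroup.toAlgEquiv K).symm
    { τ with commutes' := fun x ↦ by simpa using hτ x }
  have hg : ∀ R : (W.baseChange K).geomPoints, hτ.pointsMap W R = g • R := by
    intro R
    change ((W.baseChange K).baseChange (AlgebraicClosure K)).toAffine.Point at R
    rcases R with _ | ⟨x, y, h⟩
    · rfl
    · exact Affine.Point.some_eq_some_of_eq rfl rfl
  rw [hg, hg, φ.map_smul]

/-- **For `K` imaginary quadratic the conjugating automorphism of B6 is the non-trivial one.** `W/ℚ` elliptic, `K` imaginary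
quadratic, `φ` an endo-isogeny of `W_K` over `K` with `φ(φP) = φP − 2P` and `#ker φ = 2` (e.g. the complex multiplication
`[(1+√−7)/2]`, `j = −3375`, `K ∋ √−7`), `σ ∈ Aut(K/ℚ)`, `σ ≠ 1`, `τ` ANY lift of `σ`: then `φ(τQ) = τQ − τ(φQ)` holds on `H¹(K, E)`
in the form `H¹(φ) τ_* = τ_* − τ_* H¹(φ)`. Proof: B6's conjugating `σ'` (`exists_conjugating_lift`) is `≠ 1` — a lift of `1`
commutes with `φ` (`isogeny_pointsMap_of_isLiftOfAut_one`), contradicting the anti-commutation at `0 ≠ Q ∈ ker φ` — so `σ' = σ`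
(`#Aut(K/ℚ) = 2`, `IsGalois.card_aut_eq_finrank`), and `τ_*` does not depend on the lift (`SylvesterTwoShaConjugation.conjH1Points_eq`).
[cite: GrossLMS1991, §5 (5.1)] [cite: SilvermanATAEC1994, II §2 Thm. 2.2(b)] -/
theorem galH1Map_conjH1Points_of_isImaginaryQuadratic (hKq : IsImaginaryQuadratic K)
    (φ : Isogeny (W.baseChange K) (W.baseChange K)) (hrel : ∀ P, φ (φ P) = φ P - 2 • P)
    (hker : Nat.card φ.toAddMonoidHom.ker = 2)
    {σ : K ≃ₐ[ℚ] K} (hσ : σ ≠ 1) {τ : AlgebraicClosure K ≃+* AlgebraicClosure K} (hτ : IsLiftOfAut σ τ)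
    (c : (W.baseChange K).galH1) :
    galH1Map φ.toAddMonoidHom φ.equivariant (hτ.conjH1Points W c) =
      hτ.conjH1Points W c - hτ.conjH1Points W (galH1Map φ.toAddMonoidHom φ.equivariant c) := by
  haveI : IsGalois ℚ K := Literature.FieldTheory.Galois.isGalois_of_finrank_eq_two (F := ℚ) hKq.1
  obtain ⟨σ', τ', hτ', hanti'⟩ := exists_conjugating_lift W K φ hrel
  -- `σ' ≠ 1`
  have hσ' : σ' ≠ 1 := by
    intro h1
    subst h1
    -- a non-zero `Q ∈ ker φ`
    haveI : Finite φ.toAddMonoidHom.ker := Nat.finite_of_card_ne_zero (by rw [hker]; norm_num)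
    have hnt : Nontrivial φ.toAddMonoidHom.ker := by
      rw [← Finite.one_lt_card_iff_nontrivial, hker]; norm_num
    obtain ⟨⟨Q, hQ⟩, hQ0⟩ := exists_ne (0 : φ.toAddMonoidHom.ker)
    rw [AddMonoidHom.mem_ker] at hQ
    have hQne : Q ≠ 0 := fun h ↦ hQ0 (Subtype.ext h)
    have h := hanti' Q
    rw [isogeny_pointsMap_of_isLiftOfAut_one W hτ' φ Q] at h
    change hτ'.pointsMap W (φ.toAddMonoidHom Q) = hτ'.pointsMap W Q - hτ'.pointsMap W (φ.toAddMonoidHom Q) at h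
    rw [hQ, map_zero, sub_zero, eq_comm] at h
    -- `τ' Q = 0 ⇒ Q = 0` (apply `τ'⁻¹`)
    have := congrArg (hτ'.symm_isLiftOfAut.pointsMap W) h
    rw [map_zero] at this
    apply hQne
    rw [← this]
    change ((W.baseChange K).baseChange (AlgebraicClosure K)).toAffine.Point at Q
    rcases Q with _ | ⟨x, y, hxy⟩
    · rfl
    · exact Affine.Point.some_eq_some_of_eq (τ'.symm_apply_apply x).symm (τ'.symm_apply_apply y).symm
  -- `σ' = σ`: both non-trivial in a group of order `2`
  have hcard : Nat.card (K ≃ₐ[ℚ] K) = 2 := by rw [IsGalois.card_aut_eq_finrank, hKq.1]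
  have hσσ' : σ' = σ := by
    obtain ⟨x, y, hxy, huniv⟩ := Nat.card_eq_two_iff.mp hcard
    have h1 : (1 : K ≃ₐ[ℚ] K) ∈ ({x, y} : Set (K ≃ₐ[ℚ] K)) := huniv ▸ Set.mem_univ _
    have h2 : σ ∈ ({x, y} : Set (K ≃ₐ[ℚ] K)) := huniv ▸ Set.mem_univ _
    have h3 : σ' ∈ ({x, y} : Set (K ≃ₐ[ℚ] K)) := huniv ▸ Set.mem_univ _
    simp only [Set.mem_insert_iff, Set.mem_singleton_iff] at h1 h2 h3
    rcases h1 with rfl | rfl <;> rcases h2 with rfl | rfl <;> rcases h3 with rfl | rfl <;>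
      first | rfl | exact absurd rfl hσ | exact absurd rfl hσ'
  subst hσσ'
  -- independence of the lift
  rw [SylvesterTwoShaConjugation.conjH1Points_eq W hτ hτ']
  exact galH1Map_conjH1Points_of_anti W hτ' φ.toAddMonoidHom φ.equivariant hanti' c

/-- **THE `+`-PART OF `Ш(W_K/K)[2^∞]` FOR THE CRUX's CLASS.** `W/ℚ` elliptic with `j = −3375`, `K` imaginary quadratic with
`θ² = −7` (`K₀ = ℚ(√−7)`), `σ ∈ Aut(K/ℚ)` non-trivial (complex conjugation), `τ` ANY lift of `σ`. Then there are the complex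
multiplication `φ` (endo-isogeny, `φ(φP) = φP − 2P`, `#ker φ = 2`) and the involution `s = τ_*|_{Ш[2^∞]}` of `M = Ш(W_K/K)[2^∞]`
(over `IsLiftOfAut.conjH1Points`) such that for EVERY `2`-adic root `r` and the eigen-subgroup `C = Ш[𝔭^∞]` (`Ш(φ)` acts as `r`):
`#ker(s − id) = #ker(s + id) = #C` and `#M = (#ker(s − id))²` — the `Gal(K/ℚ)`-fixed part of `Ш(W_K/K)[2^∞]` has EXACTLY the size
of one CM-primary part, and `Ш[2^∞]` is its square (`Nat.card`; no finiteness of `Ш` assumed).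
[cite: GrossLMS1991, §5 (5.1)] [cite: SilvermanATAEC1994, II §1 Prop. 1.1, II §2 Thm. 2.2(b), App. A §3 (row D = -7)] -/
theorem exists_cm_involution_card_sha_of_isImaginaryQuadratic (hj : W.j = -3375) (hKq : IsImaginaryQuadratic K)
    {θ : K} (hθ : θ ^ 2 = -7) {σ : K ≃ₐ[ℚ] K} (hσ : σ ≠ 1)
    {τ : AlgebraicClosure K ≃+* AlgebraicClosure K} (hτ : IsLiftOfAut σ τ) :
    ∃ (φ : Isogeny (W.baseChange K) (W.baseChange K))
      (s : AddCommGroup.primaryComponent (W.baseChange K).sha 2 →+ AddCommGroup.primaryComponent (W.baseChange K).sha 2),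
      (∀ P, φ (φ P) = φ P - 2 • P) ∧ Nat.card φ.toAddMonoidHom.ker = 2 ∧
      (∀ x, (((s x : AddCommGroup.primaryComponent (W.baseChange K).sha 2) : (W.baseChange K).sha) : (W.baseChange K).galH1) =
        hτ.conjH1Points W ((x : (W.baseChange K).sha) : (W.baseChange K).galH1)) ∧
      (∀ x, s (s x) = x) ∧
      Nat.card (AddCommGroup.primaryComponent (W.baseChange K).sha 2) = Nat.card (s - AddMonoidHom.id _).ker ^ 2 ∧
      ∀ {r : ℤ_[2]}, r * r = r - 2 →
      ∀ {C : AddSubgroup (AddCommGroup.primaryComponent (W.baseChange K).sha 2)},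
        (∀ x, x ∈ C ↔ ∀ (k : ℕ) (N : ℤ), 2 ^ k • x = 0 →
          ((N : ℤ_[2]) - r) ∈ (Ideal.span {(2 : ℤ_[2]) ^ k} : Ideal ℤ_[2]) →
            galH1Map φ.toAddMonoidHom φ.equivariant
                (((x : AddCommGroup.primaryComponent (W.baseChange K).sha 2) : (W.baseChange K).sha) : (W.baseChange K).galH1) =
              N • (((x : AddCommGroup.primaryComponent (W.baseChange K).sha 2) : (W.baseChange K).sha) :
                (W.baseChange K).galH1)) →
        Nat.card (s - AddMonoidHom.id _).ker = Nat.card C ∧ Nat.card (s + AddMonoidHom.id _).ker = Nat.card C := by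
  haveI : Fact (Nat.Prime 2) := ⟨Nat.prime_two⟩
  haveI : IsGalois ℚ K := Literature.FieldTheory.Galois.isGalois_of_finrank_eq_two (F := ℚ) hKq.1
  haveI : IsTotallyComplex K := hKq.2
  have hK : ∀ w : InfinitePlace K, w.IsComplex := fun w ↦ IsTotallyComplex.isComplex w
  obtain ⟨φ, hrel, hker, -⟩ := exists_cmIsogeny_card_sha_two_primary_eq_sq W hj K hK hθ
  -- `σ² = 1` (order `2`), and the anti-commutation for THIS lift on `H¹`
  have hcard : Nat.card (K ≃ₐ[ℚ] K) = 2 := by rw [IsGalois.card_aut_eq_finrank, hKq.1]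
  have hσ2 : σ * σ = 1 := by
    haveI : Finite (K ≃ₐ[ℚ] K) := Nat.finite_of_card_ne_zero (by rw [hcard]; norm_num)
    have h : σ ^ Nat.card (K ≃ₐ[ℚ] K) = 1 := pow_card_eq_one'
    rwa [hcard, pow_two] at h
  have hantiH := galH1Map_conjH1Points_of_isImaginaryQuadratic W hKq φ hrel hker hσ hτ
  -- the involution `s` and the swap structure, as in §2 but with the `H¹`-level anti-commutation
  set M := ↥(AddCommGroup.primaryComponent (W.baseChange K).sha 2) with hM_def
  obtain ⟨πM, hπM, hπMrel⟩ := exists_shaPi_two (W.baseChange K) φ hrel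
  obtain ⟨g, hg⟩ := exists_conj_addEquiv_sha_two W hK hτ
  set s : M →+ M := (g : M →+ M) with hs_def
  have hs : ∀ x, (((s x : M) : (W.baseChange K).sha) : (W.baseChange K).galH1) =
      hτ.conjH1Points W ((x : (W.baseChange K).sha) : (W.baseChange K).galH1) := fun x ↦ hg x
  have hss : ∀ x, s (s x) = x := fun x ↦ by
    apply Subtype.ext; apply Subtype.ext
    rw [hs, hs]
    exact SylvesterTwoShaConjugation.conjH1Points_conjH1Points_of_mul_self W hσ2 hτ _
  have hgM : ∀ x : M, πM (s x) = (1 : ℤ) • s x - s (πM x) := fun x ↦ by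
    apply Subtype.ext; apply Subtype.ext
    rw [one_smul, AddSubgroupClass.coe_sub, AddSubgroupClass.coe_sub, hπM, hs, hs, hπM]
    exact hantiH _
  have hcoe : ∀ (x : M) (N : ℤ), πM x = N • x ↔
      galH1Map φ.toAddMonoidHom φ.equivariant (((x : M) : (W.baseChange K).sha) : (W.baseChange K).galH1) =
        N • (((x : M) : (W.baseChange K).sha) : (W.baseChange K).galH1) := fun x N ↦ by
    rw [← hπM x]
    constructor
    · intro h; rw [h, AddSubgroupClass.coe_zsmul, AddSubgroupClass.coe_zsmul]
    · intro h
      apply Subtype.ext; apply Subtype.ext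
      rw [h, AddSubgroupClass.coe_zsmul, AddSubgroupClass.coe_zsmul]
  -- a fixed root `r₀` for the square count
  obtain ⟨r₀, hr₀, -⟩ := exists_padicInt_two_root
  have key : ∀ {r : ℤ_[2]}, r * r = r - 2 →
      ∀ {C : AddSubgroup M}, (∀ x : M, x ∈ C ↔ ∀ (k : ℕ) (N : ℤ), 2 ^ k • x = 0 →
        ((N : ℤ_[2]) - r) ∈ (Ideal.span {(2 : ℤ_[2]) ^ k} : Ideal ℤ_[2]) → πM x = N • x) →
      Nat.card (s - AddMonoidHom.id _).ker = Nat.card C ∧ Nat.card (s + AddMonoidHom.id _).ker = Nat.card C ∧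
        Nat.card M = Nat.card (s - AddMonoidHom.id _).ker ^ 2 := by
    intro r hr C hC₁
    have hsum : r + (1 - r) = ((1 : ℤ) : ℤ_[2]) := by push_cast; ring
    have hsum' : (1 - r) + r = ((1 : ℤ) : ℤ_[2]) := by push_cast; ring
    have hprod : r * (1 - r) = ((2 : ℤ) : ℤ_[2]) := by push_cast; linear_combination -hr
    have hunit : IsUnit (r - (1 - r)) := (two_dvd_or_two_dvd_one_sub_of_root hr).2
    obtain ⟨C', hC'⟩ := exists_addSubgroup_eigen (p := 2) exists_two_pow_smul_eq_zero_primaryComponent πM (1 - r)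
    obtain ⟨hinf, hsup, -⟩ := natCard_eq_natCard_eigen_mul (p := 2) exists_two_pow_smul_eq_zero_primaryComponent πM hπMrel
      hsum hprod hunit hC₁ hC'
    have h12 : ∀ x ∈ C, s x ∈ C' := fun x hx ↦
      (hC' _).mpr (eigen_map_of_anticommute πM s hgM hsum (exists_two_pow_smul_eq_zero_primaryComponent x) ((hC₁ x).mp hx))
    have h21 : ∀ x ∈ C', s x ∈ C := fun x hx ↦
      (hC₁ _).mpr (eigen_map_of_anticommute πM s hgM hsum' (exists_two_pow_smul_eq_zero_primaryComponent x) ((hC' x).mp hx))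
    exact ⟨natCard_ker_sub_id_eq_of_swap hinf hsup s hss h12 h21, natCard_ker_add_id_eq_of_swap hinf hsup s hss h12 h21,
      natCard_eq_sq_natCard_ker_sub_id_of_swap hinf hsup s hss h12 h21⟩
  obtain ⟨C₀, hC₀⟩ := exists_addSubgroup_eigen (p := 2) exists_two_pow_smul_eq_zero_primaryComponent πM r₀
  refine ⟨φ, s, hrel, hker, hs, hss, (key hr₀ hC₀).2.2, fun hr C hC ↦ ?_⟩
  have hC₁ : ∀ x : M, x ∈ C ↔ ∀ (k : ℕ) (N : ℤ), 2 ^ k • x = 0 →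
      ((N : ℤ_[2]) - _) ∈ (Ideal.span {(2 : ℤ_[2]) ^ k} : Ideal ℤ_[2]) → πM x = N • x := fun x ↦ by
    rw [hC x]
    exact forall_congr' fun k ↦ forall_congr' fun N ↦ forall_congr' fun _ ↦ forall_congr' fun _ ↦ (hcoe x N).symm
  obtain ⟨h1, h2, -⟩ := key hr hC₁
  exact ⟨h1, h2⟩

end ImaginaryQuadratic

end Summit.BirchSwinnertonDyer.BirchSwinnertonDyer.Theorems.PrintCf2.CMPrimes

end
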